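import Summits.MatrixMultiplication.OmegaCensus.STPPRepresentationCount
import Literature.Combinatorics.Additive.TripleProductProperty
import Literature.Barriers.MatrixMultiplication.QuasirandomBarrierSTPP

/-!
# ω-census: the representation count and filter N10 in ANY finite group; cubes need `|G| ≥ 8k − 2` everywhere

HONEST FRAMING (pub-omega census; verbatim): lottery ticket; floor = certified bounds/negative ranges.
Census STRUCTURE (seat pub-omega-stpp-1 gen 24, 2026-08-27; lead ruling L32-28 (i): "state whether the pigeonhole half holds for
ALL finite groups — if yes, file that half group-general").  Nothing here is progress on `ω`.

The companion files `STPPRepresentationCount.lean` / `STPP222NeverBeats*.lean` work with the tree's ABELIAN predicate `IsSTPP`.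
This file redoes the Kneser-free half for CKSU Def. 5.1 VERBATIM IN AN ARBITRARY GROUP — the tree's
`Literature.Combinatorics.Additive.SimultaneousTPP` (clause (i) = TPP of each triple, clause (ii) = the word
`a a'⁻¹ b b'⁻¹ c c'⁻¹ = 1` forces `i = j = k`).  The word rewrites as `(a'⁻¹ b)(b'⁻¹ c) = a⁻¹ c'`, so with the quotient-set
unions `X = ⋃ᵢ Aᵢ⁻¹Bᵢ`, `Y = ⋃ᵢ Bᵢ⁻¹Cᵢ` (`QU A B`, `QU B C`) and `z = a⁻¹c'` (`a ∈ A_j`, `c' ∈ C_j`):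

* `repMul_eq_card_B` — the number of factorisations `z = x·y` (`x ∈ X`, `y ∈ Y`) is EXACTLY `|B_j|` (no commutativity used);
* `card_add_card_le_repMul_add` — pigeonhole `#X + #Y ≤ repMul X Y g + |G|` in any finite group;
* `card_QU_AB`, `card_QU_BC` — `#X = Σ|Aᵢ||Bᵢ|` (all `Cᵢ ≠ ∅`), `#Y = Σ|Bᵢ||Cᵢ|` (all `Aᵢ ≠ ∅`) — the BCCGNSU packing injectivity
  (as in the tree's `SimultaneousTPP.sum_card_mul_card_le`);
* **`n10Mul` — FILTER N10 IN ANY FINITE GROUP: `Σᵢ|Aᵢ||Bᵢ| + Σᵢ|Bᵢ||Cᵢ| ≤ |G| + |B_j|` for every block `j`**, its rotations via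
  the tree's `Literature.Barriers.MatrixMultiplication.simultaneousTPP_rotate` (Def. 5.1 is invariant under `(A,B,C) ↦ (B,C,A)`), and the card-vector form
  `not_simultaneousTPP_of_n9Dead` on the SAME decidable predicate `CubeNB.N9Dead` as the abelian file (naming: the predicate is
  the lead's filter "N10"; the identifier keeps the name under which it first landed);
* **`eight_mul_le_card_add_two` — in ANY finite group, `k` simultaneous-TPP triples of 2-subsets force `8k ≤ |G| + 2`.**

What is NOT here (and why).  The last two steps of the abelian theorem (`|H| ≠ 8k − 2` via the stabilizer of `Y`, `|H| ≠ 8k − 1`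
via Kneser) are not ported: Kneser's theorem is abelian, and the stabilizer step, though inversion-free on paper, needs the
coset arithmetic of `Finset.mulStab` that the tree proves only for commutative groups.  Consequence worth recording in prose
(NOT a kernel theorem here): for a NON-abelian `G`, beating the sum of cubes with `(2,2,2)^k` would need `8k > Σ_χ d_χ³ ≥ |G| + 4`
(some `d_χ ≥ 2`, `Σ d_χ² = |G|`), impossible by `8k ≤ |G| + 2`; together with `CubeNB.eight_mul_le_card` (abelian: `8k ≤ |H|`)
the pure-cube class never beats the sum of cubes in any finite group.

References: H. Cohn, R. Kleinberg, B. Szegedy, C. Umans, FOCS 2005 (arXiv:math/0511460), Def. 5.1; J. Blasiak, T. Church,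
H. Cohn, J. A. Grochow, E. Naslund, W. F. Sawin, C. Umans, Discrete Analysis 2017:3, §2 (packing bounds).
-/

open Finset

namespace Summit.MatrixMultiplication.OmegaCensus.CubeNB

open Literature.Combinatorics.Additive

variable {G : Type*} [Group G] [DecidableEq G]

/-- Multiplicative representation count: `repMul X Y g = #{x ∈ X : x⁻¹ g ∈ Y}`, the number of factorisations `g = x·y`
with `x ∈ X`, `y ∈ Y` (any group). [folklore] -/
def repMul (X Y : Finset G) (g : G) : ℕ := #(X.filter fun x => x⁻¹ * g ∈ Y)

/-- Pigeonhole in any finite group: `#X + #Y ≤ repMul X Y g + |G|` (`{x : x⁻¹g ∈ Y} = g Y⁻¹` has `#Y` elements). [folklore] -/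
theorem card_add_card_le_repMul_add [Fintype G] (X Y : Finset G) (g : G) :
    #X + #Y ≤ repMul X Y g + Fintype.card G := by
  have hT : X.filter (fun x => x⁻¹ * g ∈ Y) = X ∩ Y.image (fun y => g * y⁻¹) := by
    ext x
    simp only [mem_filter, mem_inter, mem_image]
    refine and_congr_right fun _ => ⟨fun h => ⟨x⁻¹ * g, h, by group⟩, ?_⟩
    rintro ⟨y, hy, rfl⟩
    simpa using hy
  have hc : #(Y.image fun y => g * y⁻¹) = #Y :=
    card_image_of_injective _ fun y y' (h : g * y⁻¹ = g * y'⁻¹) => by simpa using h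
  rw [repMul, hT]
  have h1 := card_union_add_card_inter X (Y.image fun y => g * y⁻¹)
  have h2 : #(X ∪ Y.image fun y => g * y⁻¹) ≤ Fintype.card G := card_le_univ _
  omega

section STPP

variable {ι : Type*} [Fintype ι] {A B C : ι → Finset G}

/-- The quotient-set union `⋃ᵢ Eᵢ⁻¹Fᵢ = {e⁻¹ f : e ∈ Eᵢ, f ∈ Fᵢ}` of a family of pairs, as the image of the sigma finset. [folklore] -/
def QU (E F : ι → Finset G) : Finset G := (univ.sigma fun i => E i ×ˢ F i).image fun x => x.2.1⁻¹ * x.2.2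

/-- Membership in `QU`. [folklore] -/
theorem mem_QU {E F : ι → Finset G} {g : G} : g ∈ QU E F ↔ ∃ i, ∃ e ∈ E i, ∃ f ∈ F i, e⁻¹ * f = g := by
  simp only [QU, mem_image, mem_sigma, mem_univ, true_and, mem_product, Sigma.exists, Prod.exists]
  constructor
  · rintro ⟨i, e, f, ⟨he, hf⟩, h⟩; exact ⟨i, e, he, f, hf, h⟩
  · rintro ⟨i, e, he, f, hf, h⟩; exact ⟨i, e, f, ⟨he, hf⟩, h⟩

/-- `#(⋃ᵢ Aᵢ⁻¹Bᵢ) = Σᵢ |Aᵢ||Bᵢ|` for an STPP family with all `Cᵢ ≠ ∅` (the BCCGNSU packing injectivity, any group).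
[cite: BlasiakChurchCohnGrochowNaslundSawinUmans2017, §2] -/
theorem card_QU_AB (h : SimultaneousTPP A B C) (hC : ∀ i, (C i).Nonempty) :
    #(QU A B) = ∑ i, #(A i) * #(B i) := by
  classical
  set D : Finset (Σ _ : ι, G × G) := univ.sigma fun i => A i ×ˢ B i with hD
  have hinj : Set.InjOn (fun x : (Σ _ : ι, G × G) => x.2.1⁻¹ * x.2.2) ↑D := by
    rintro ⟨i, a, b⟩ hx ⟨j, a', b'⟩ hy (he : a⁻¹ * b = a'⁻¹ * b')
    simp only [hD, coe_sigma, Set.mem_sigma_iff, coe_univ, Set.mem_univ, true_and, coe_product, Set.mem_prod,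
      mem_coe] at hx hy
    obtain ⟨c, hc⟩ := hC j
    have key : a' * a⁻¹ * b * b'⁻¹ * c * c⁻¹ = 1 := by
      rw [mul_inv_cancel_right, mul_assoc a', he, mul_inv_cancel_left, mul_inv_cancel]
    obtain ⟨rfl, -⟩ := h.2 j i j a' hy.1 a hx.1 b hx.2 b' hy.2 c hc c hc key
    have key' : a' * a⁻¹ * (b * b'⁻¹) * (c * c⁻¹) = 1 := by simpa only [mul_assoc] using key
    obtain ⟨h1, h2, -⟩ := h.1 _ a' hy.1 a hx.1 b hx.2 b' hy.2 c hc c hc key'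
    subst h1 h2
    rfl
  rw [QU, card_image_of_injOn hinj, hD, card_sigma]
  simp only [card_product]

/-- `#(⋃ᵢ Bᵢ⁻¹Cᵢ) = Σᵢ |Bᵢ||Cᵢ|` for an STPP family with all `Aᵢ ≠ ∅` (any group). [cite: BlasiakChurchCohnGrochowNaslundSawinUmans2017, §2] -/
theorem card_QU_BC (h : SimultaneousTPP A B C) (hA : ∀ i, (A i).Nonempty) :
    #(QU B C) = ∑ i, #(B i) * #(C i) := by
  classical
  set D : Finset (Σ _ : ι, G × G) := univ.sigma fun i => B i ×ˢ C i with hD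
  have hinj : Set.InjOn (fun x : (Σ _ : ι, G × G) => x.2.1⁻¹ * x.2.2) ↑D := by
    rintro ⟨p, b₁, c₁⟩ hx ⟨q, b₂, c₂⟩ hy (he : b₁⁻¹ * c₁ = b₂⁻¹ * c₂)
    simp only [hD, coe_sigma, Set.mem_sigma_iff, coe_univ, Set.mem_univ, true_and, coe_product, Set.mem_prod,
      mem_coe] at hx hy
    obtain ⟨a, ha⟩ := hA q
    -- word with indices (q, q, p): a a⁻¹ b₂ b₁⁻¹ c₁ c₂⁻¹ = 1
    have key : a * a⁻¹ * b₂ * b₁⁻¹ * c₁ * c₂⁻¹ = 1 := by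
      have : b₂ * b₁⁻¹ * c₁ = c₂ := by
        rw [mul_assoc, he, mul_inv_cancel_left]
      rw [mul_inv_cancel, one_mul, this, mul_inv_cancel]
    obtain ⟨-, rfl⟩ := h.2 q q p a ha a ha b₂ hy.1 b₁ hx.1 c₁ hx.2 c₂ hy.2 key
    have key' : a * a⁻¹ * (b₂ * b₁⁻¹) * (c₁ * c₂⁻¹) = 1 := by simpa only [mul_assoc] using key
    obtain ⟨-, h2, h3⟩ := h.1 _ a ha a ha b₂ hy.1 b₁ hx.1 c₁ hx.2 c₂ hy.2 key'
    subst h2 h3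
    rfl
  rw [QU, card_image_of_injOn hinj, hD, card_sigma]
  simp only [card_product]

/-- **Representation count in ANY finite group.**  For an STPP family (CKSU Def 5.1 verbatim, `SimultaneousTPP`) and
`z = a⁻¹c'` with `a ∈ A_j`, `c' ∈ C_j`: the number of factorisations `z = x·y`, `x ∈ ⋃ Aᵢ⁻¹Bᵢ`, `y ∈ ⋃ Bᵢ⁻¹Cᵢ`, is EXACTLY `|B_j|`
(they are `x = a⁻¹b`, `y = b⁻¹c'`, `b ∈ B_j`: clause (ii) with the word `a a'⁻¹ b b'⁻¹ c c'⁻¹ = 1 ⟺ (a'⁻¹b)(b'⁻¹c) = a⁻¹c'`, then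
clause (i)).  No commutativity is used. [cite: CohnKleinbergSzegedyUmans2005, Def. 5.1] -/
theorem repMul_eq_card_B (h : SimultaneousTPP A B C) {j : ι} {a c' : G} (ha : a ∈ A j) (hc' : c' ∈ C j) :
    repMul (QU A B) (QU B C) (a⁻¹ * c') = #(B j) := by
  have hset : (QU A B).filter (fun x => x⁻¹ * (a⁻¹ * c') ∈ QU B C) = (B j).image (fun b => a⁻¹ * b) := by
    ext x
    simp only [mem_filter, mem_image, mem_QU]
    constructor
    · rintro ⟨⟨i, a', ha', b, hb, rfl⟩, ⟨l, b', hb', c, hc, hy⟩⟩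
      -- hy : b'⁻¹ * c = (a'⁻¹ * b)⁻¹ * (a⁻¹ * c')
      have key : a * a'⁻¹ * b * b'⁻¹ * c * c'⁻¹ = 1 := by
        have e1 : b'⁻¹ * c = b⁻¹ * a' * a⁻¹ * c' := by rw [hy]; group
        have e2 : a * a'⁻¹ * b * b'⁻¹ * c * c'⁻¹ = a * a'⁻¹ * b * (b'⁻¹ * c) * c'⁻¹ := by group
        rw [e2, e1]; group
      obtain ⟨hji, hil⟩ := h.2 j i l a ha a' ha' b hb b' hb' c hc c' hc' key
      subst hji; subst hil
      have key' : a * a'⁻¹ * (b * b'⁻¹) * (c * c'⁻¹) = 1 := by simpa only [mul_assoc] using key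
      obtain ⟨h1, -, -⟩ := h.1 _ a ha a' ha' b hb b' hb' c hc c' hc' key'
      subst h1
      exact ⟨b, hb, rfl⟩
    · rintro ⟨b, hb, rfl⟩
      refine ⟨⟨j, a, ha, b, hb, rfl⟩, ⟨j, b, hb, c', hc', by group⟩⟩
  rw [repMul, hset, card_image_of_injective _ fun b b' (e : a⁻¹ * b = a⁻¹ * b') => by simpa using e]

/-- **Filter N10 in ANY finite group.**  For an STPP family (CKSU Def 5.1) with non-empty `Aᵢ`, `Cᵢ` and every block `j`:
`Σᵢ|Aᵢ||Bᵢ| + Σᵢ|Bᵢ||Cᵢ| ≤ |G| + |B_j|`.  (Commutativity is NOT used; the abelian `IsSTPP` form is `CubeNB.n9` of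
`STPPRepresentationCount.lean`.) [cite: CohnKleinbergSzegedyUmans2005, Def. 5.1] -/
theorem n10Mul [Fintype G] (h : SimultaneousTPP A B C) (hA : ∀ i, (A i).Nonempty) (hC : ∀ i, (C i).Nonempty) (j : ι) :
    ∑ i, #(A i) * #(B i) + ∑ i, #(B i) * #(C i) ≤ Fintype.card G + #(B j) := by
  obtain ⟨a, ha⟩ := hA j
  obtain ⟨c', hc'⟩ := hC j
  have hp := card_add_card_le_repMul_add (QU A B) (QU B C) (a⁻¹ * c')
  rw [repMul_eq_card_B h ha hc', card_QU_AB h hC, card_QU_BC h hA] at hp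
  omega

/-- **Filter N10, card-vector form, in ANY finite group**: an STPP family with non-empty sets whose pattern is
`N9Dead |G|` (the N10 predicate of `STPPRepresentationCount.lean`; three rotations) does not exist. [cite: CohnKleinbergSzegedyUmans2005, Def. 5.1] -/
theorem not_simultaneousTPP_of_n9Dead [Fintype G] {N : ℕ} {A B C : Fin N → Finset G} (h : SimultaneousTPP A B C)
    (hA : ∀ i, (A i).Nonempty) (hB : ∀ i, (B i).Nonempty) (hC : ∀ i, (C i).Nonempty) {n : ℕ}
    (hn : Fintype.card G = n) {a b c : Fin N → ℕ} (ha : ∀ i, #(A i) = a i) (hb : ∀ i, #(B i) = b i)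
    (hc : ∀ i, #(C i) = c i) (hdead : N9Dead n N a b c = true) : False := by
  simp only [N9Dead, Bool.or_eq_true, N9Dead1, decide_eq_true_eq] at hdead
  rcases hdead with (⟨j, hj⟩ | ⟨j, hj⟩) | ⟨j, hj⟩
  · have := n10Mul h hA hC j
    simp only [ha, hb, hc, hn] at this; omega
  · have := n10Mul (Literature.Barriers.MatrixMultiplication.simultaneousTPP_rotate h) hB hA j
    simp only [ha, hb, hc, hn] at this; omega
  · have := n10Mul (Literature.Barriers.MatrixMultiplication.simultaneousTPP_rotate
      (Literature.Barriers.MatrixMultiplication.simultaneousTPP_rotate h)) hC hB j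
    simp only [ha, hb, hc, hn] at this; omega

/-- **Cubes in ANY finite group: `8k ≤ |G| + 2`.**  If a finite group `G` carries `k` triples of 2-subsets with CKSU's simultaneous
triple product property, then `8k ≤ |G| + 2` (N10 at any block: `4k + 4k ≤ |G| + 2`).  Kneser-free; for abelian `G` the sharp form
`8k ≤ |G|` is `CubeNB.eight_mul_le_card`. [cite: CohnKleinbergSzegedyUmans2005, Def. 5.1] -/
theorem eight_mul_le_card_add_two [Fintype G] {k : ℕ} {A B C : Fin k → Finset G} (h : SimultaneousTPP A B C)
    (hc : ∀ i, #(A i) = 2 ∧ #(B i) = 2 ∧ #(C i) = 2) : 8 * k ≤ Fintype.card G + 2 := by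
  rcases Nat.eq_zero_or_pos k with hk | hk
  · subst hk; simp
  · have hA : ∀ i, (A i).Nonempty := fun i => card_pos.1 (by rw [(hc i).1]; norm_num)
    have hC : ∀ i, (C i).Nonempty := fun i => card_pos.1 (by rw [(hc i).2.2]; norm_num)
    have := n10Mul h hA hC ⟨0, hk⟩
    simp only [hc] at this
    simp only [sum_const, card_univ, Fintype.card_fin, smul_eq_mul] at this
    omega

end STPP

end Summit.MatrixMultiplication.OmegaCensus.CubeNB
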